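import Literature.MathematicalPhysics.QuantumFieldTheory.Balaban1983to89.B8Prop7PrintedRZdGF3BoxFormInterTower
import Literature.MathematicalPhysics.QuantumFieldTheory.Balaban1983to89.B7GaugeFixingPureGaugeCStar
import Literature.MathematicalPhysics.QuantumFieldTheory.Balaban1983to89.B8Eq140PureGaugePotentialCStar
import Literature.MathematicalPhysics.QuantumFieldTheory.Balaban1983to89.B8Prop7PrintedRZdGF3P2HalfSpaceCStar

/-!
# `Balaban1983to89.B8Prop7PrintedRZdGF3BoxFormInterTowerCStar` — the C⋆-ALGEBRA EDITION of the box-form P₇-currency certificate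
# `B8Prop7PrintedRZdGF3BoxFormInterTower`: the typed-printed Proposition 7 of [Balaban1985RegularSpaces] (constant `2α₂` in (1.145)), BOX FORM, print's
# PINNED tower-wise map, is FALSE at the inter-tower bond of the cube member for `d = 4`, every `L ≥ 9` and EVERY nontrivial coefficient C⋆-algebra `𝔸`;
# hence the box-form record faces at EVERY `θ : Node00.Stage3Params` with `θ.D = 4`, `θ.L ≥ 9`, whatever `θ.𝔸`

statement-level skeleton of published theorems with citation tags; proofs where landed; nothing here is a claim about the Yang–Mills mass gap

T. Bałaban, *Spaces of regular gauge field configurations on a lattice and gauge fixing conditions*, Commun. Math. Phys. **99** (1985) 75–102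
`[Balaban1985RegularSpaces]` ("B8"): Prop. 7 (1.143)–(1.145) p. 100, (1.139)–(1.140) p. 100, (1.35) p. 82, (1.66) p. 88, (1.3)–(1.6) p. 77, (1.131) p. 99.
T. Bałaban, *Averaging operations for lattice gauge theories*, Commun. Math. Phys. **98** (1985) 17–51 `[Balaban1985Averaging]` ("[3]"): (76)–(77) pp. 29–30,
(81) p. 30, (85) p. 31, (87) p. 31, (88) p. 31.

## WHY THIS FILE (cell `pub-ymgap`, HUMAN RULING D-0062 ∕ D-0149 ∕ D-0154; N05 = [B8]; width seat `pub-ymgap-dag-n05-w5` g3)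

`B8Prop7PrintedRZdGF3BoxFormInterTower` is the scalar-model (`𝔸 = ℂ`) certificate, enough for the ℂ-dictionaries of record (`stage3OfFamily F`).  NODE 00's Stage-3
records carry a general coefficient C⋆-algebra `θ.𝔸`; as the lineage did for the P-carriers (`B8Prop7PrintedRZdGF3P2HalfSpaceCStar`), this file re-runs the box-form
certificate with the CENTRAL pure gauge `e^{iψ}·1` so that the record faces hold at EVERY `θ` with `θ.D = 4` and `θ.L ≥ 9`, any `θ.𝔸`.  The member, the potential
and the arithmetic are those of the scalar edition BY NAME (`B8Prop7BoxFormWitness`, `B8Eq140PureGaugePotential.sideTouches_coord_le`); only the gauge-fixing calculus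
(`B7GaugeFixingPureGaugeCStar`) and the (1.140) bookkeeping (`B8Eq140PureGaugePotentialCStar`) are the C⋆ twins.

## WHAT IS PROVED (kernel, 0 sorry; theorems only)

★★ `not_prop7PrintedR_zdGF3_toAxialTower_boxForm_cstar (𝔸) (L) (hL9 : 9 ≤ L) …` (+ the `d`-keyed form `…_cstar_dim (hd : d = 4)`), and §4 the record faces at
EVERY `θ : Node00.Stage3Params` with `θ.D = 4`, `9 ≤ θ.L` (any `θ.𝔸`, `β`, `len`): ★ `exists_idxB8SubB_not_prop7PrintedR_boxForm`, ★★ `not_prop7PrintedR_famB8OfRecordSubB_toAxialTowerResid`,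
★★ `not_prop7PrintedR_famB8OfRecord_toAxialTowerResid`, ★★ `not_prop7PrintedR_famB8OfRecordSubBH_toAxialTowerResid`.

## HONEST SCOPE ∕ LIMITS

As the scalar edition: a NEGATIVE certificate about a proof CURRENCY for `L ≥ 9` ONLY; NO estimate of [Balaban1985RegularSpaces] proved anew or denied; the repaired
currency holds.  Count-neutral helper keyed `stmt-QuantumFields-26907` (K1⁸ `StabilityBRunRowsAtRecordR13SepCoPH`, route rev 27; successor of the aside K1⁷ 20542);
N05 NOT discharged; no summit statement is proved by this seat — R4 closes the conditional finite-`𝕋⁴` rung `BalabanLadder.UV` only; nothing continuum ∕ ℝ⁴ ∕ OS ∕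
mass-gap ∕ Clay.  No `sorry`, no `def`, no `instance`, no `notation`.  Unit `pub-ymgap-dag-n05-w5` (g3), 2026-08-28.

[cite: Balaban1985RegularSpaces, Prop. 7 (1.143)–(1.145) p.100, (1.139)–(1.140) p.100, (1.35) p.82, (1.66) p.88, (1.3)–(1.6) p.77, (1.131) p.99;
Balaban1985Averaging, (76)–(77) pp.29–30, (81) p.30, (85) p.31, (87) p.31, (88) p.31]
-/

noncomputable section

open NormedSpace Finset

namespace Literature.MathematicalPhysics.QuantumFieldTheory.Balaban1983to89.B8Prop7PrintedRZdGF3BoxFormInterTowerCStar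

open Complex (I)
open B7Prop1Explicit B7Prop1Local B7Prop2Explicit B7Eq92Concrete B7Eq84Concrete B7AvgGaugeCovariance
open B8Ineq130 (tlo thi tlo_apply thi_apply fl)
open B8Ineq132 (Under InAk covDerivFwd PlaqTouches)
open B8Eq140Level (SideTouches IsSide)
open B8Eq143PlaqExpansion (pdiv)
open B8Eq146AExpansion (plaqCovDeriv plaqCovDeriv_eq_covDerivFwd)
open B8Eq184Proof (cfgExp)
open B8Lemma1NonAbelian (mulCfg)
open B8Thm4Concrete (mulCfg_eq_mul)
open B8IdxB8LawsB (IdxB8LawsB IdxB8SubB famB8OfRecordSubB)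
open B8ConstraintBonds (DomainSeq)
open B8LeafModelZd (ZdIdx)
open B8LeafModelZd3 (zdGF3 mlogCfg mlogCfg_spec)
open B8Prop7AdmittedFamily (cst cst_pos)
open B8Prop7TowerAxialZd3 (uTower toAxialTower toAxialTower_of_unitary uTower_of_maximal InTower)
open B8Prop7TowerAxialUnitary (uTower_facts)
open B8Eq115GaugeFixing (fl_block)
open B8Eq131Cubes (cube sqLo sqHi bLo bHi gs gs_zero gs_succ)
open B8Eq131CubesAdmissible (cubeFam cubeFam_true_zero cubeFam_of_pos cubeFam_domainSeq)
open B8SockB9P3ShellModeVacuityUniv (exists_topCube_member_lawsB)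
open B8Eq106Local (under_iff_tower)
open B8Eq131Derivation (under_zero_iff under_one_block under_succ_of_under_block)
open B8Ineq145 (stairMean stairMean_eq)
open B8Ineq145Lineage (eI)
open B9SupplySockB9P3ZdSocketBoundaryMode (cfgExp_mem_unitaryUnits)
open B7GaugeFixingPureGauge (sum_inv_card_box)
open B7GaugeFixingPureGaugeCStar (norm_mgauge_interTower_sub_one_cu cfgExp_potential_eq_gaugeAct_cu)
open B8Eq140PureGaugePotential (sideTouches_coord_le)
open B8Eq140PureGaugePotentialCStar (c140_zdGF3_potential)
open B8Prop7BoxFormWitness (potential_bounds potential_values block_means smallness)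

-- `Site` alone could resolve to the torus sites of `Setup.lean`; re-export the `ℤ^d` sites of `B7Prop1Explicit`.
export B7Prop1Explicit (Site)

variable {𝔸 : Type} [CStarAlgebra 𝔸] [Nontrivial 𝔸]

/-! ## §3 The certificate over an arbitrary coefficient C⋆-algebra -/

section Certificate

variable (𝔸)

/-- The arithmetic of the witness (private plumbing): with `κ₀L² = 0.9999·α₂`, `α₂ ≤ 1∕32`, `L ≥ 9`, the phase `X = κ₀(13L² − 9L + 2)∕12` satisfies
`X ≥ 1.0019·α₂` (since `(L − 9)(79L − 18) ≥ 0`) and `X ≤ 1∕25`, so `sin X > X − X³∕4 > α₂`: the box-form (1.145) bound `2|sin(−X)| ≤ 2α₂` is absurd.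
[cite: Balaban1985RegularSpaces, Prop. 7 (1.145) p.100 (bookkeeping: the arithmetic of the located failure)] -/
private theorem final_arith {L α₂ κ₀ : ℝ} (hL : 9 ≤ L) (h0 : 0 < α₂) (h32 : α₂ ≤ 1 / 32) (hκ₀ : 0 < κ₀)
    (hκ₀L2 : κ₀ * L ^ 2 = 9999 / 10000 * α₂)
    (hle : 2 * |Real.sin ((κ₀ * (L * (L * (4 * L) + 2 * (L - 1)) + 2 * (L - 1))
      - κ₀ * (L * (4 * L ^ 2 + 4 * L - 3) + 2 * (L - 1) + (L ^ 4)⁻¹ * (L ^ 3 * (L * (L - 1) * (L - 2) / 6)))) / 2)| ≤ 2 * α₂) :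
    False := by
  have hLpos : (0 : ℝ) < L := by linarith
  have hL0 : L ≠ 0 := hLpos.ne'
  set X : ℝ := κ₀ * (13 * L ^ 2 - 9 * L + 2) / 12 with hXdef
  have hΦ : (κ₀ * (L * (L * (4 * L) + 2 * (L - 1)) + 2 * (L - 1))
      - κ₀ * (L * (4 * L ^ 2 + 4 * L - 3) + 2 * (L - 1) + (L ^ 4)⁻¹ * (L ^ 3 * (L * (L - 1) * (L - 2) / 6)))) / 2 = -X := by
    rw [hXdef]; field_simp; ring
  have hρ : 487 * 12 * L ^ 2 ≤ 486 * (13 * L ^ 2 - 9 * L + 2) := by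
    nlinarith [mul_nonneg (sub_nonneg.mpr hL) (show (0:ℝ) ≤ 79 * L - 18 by linarith)]
  have hX12 : 12 * X * L ^ 2 = 9999 / 10000 * α₂ * (13 * L ^ 2 - 9 * L + 2) := by
    rw [hXdef, ← hκ₀L2]; field_simp
  have hL2pos : (0 : ℝ) < L ^ 2 := by positivity
  have hXlo : 10019 / 10000 * α₂ ≤ X := by nlinarith
  have hXhi : X ≤ 1 / 25 := by nlinarith
  have hX0 : 0 < X := by linarith
  have hXπ : X < Real.pi := by linarith [Real.pi_gt_three]
  rw [hΦ, Real.sin_neg, abs_neg, abs_of_pos (Real.sin_pos_of_pos_of_lt_pi hX0 hXπ)] at hle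
  have hs := Real.sin_gt_sub_cube hX0
  have hX2 : X ^ 2 ≤ 1 / 625 := by nlinarith
  have hX3 : X ^ 3 / 6 ≤ X / 3750 := by
    have : X ^ 3 = X * X ^ 2 := by ring
    rw [this]; nlinarith
  nlinarith

/-- ★★ **THE C⋆-ALGEBRA EDITION OF THE BOX-FORM CERTIFICATE**: [Balaban1985RegularSpaces] Proposition 7 AS TYPED-PRINTED (`B8SectGH.Prop7PrintedR`,
constant `2α₂` in (1.145)) is FALSE in the box form of NODE 00's carrier `zdGF3 𝔸` with print's pinned tower-wise map, at the inter-tower bond of print's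
cube family `(T, □₁, □₂)` — `d = 4`, every `L ≥ 9`, and now an ARBITRARY nontrivial coefficient C⋆-algebra `𝔸` (e.g. `M_N(ℂ)`): the witness of
`B8Prop7PrintedRZdGF3BoxFormInterTower` with the CENTRAL pure gauge `U₁ = e^{−i dψ}·1 ∈ U(𝔸)` (`B7GaugeFixingPureGaugeCStar`); same member, same potential
(`B8Prop7BoxFormWitness`), same arithmetic. [cite: Balaban1985RegularSpaces, Prop. 7 (1.143)–(1.145) p.100, (1.139)–(1.140) p.100, (1.66) p.88, (1.3)–(1.6) p.77, (1.131) p.99; Balaban1985Averaging, (76)–(77) pp.29–30, (81) p.30, (87) p.31] -/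
theorem not_prop7PrintedR_zdGF3_toAxialTower_boxForm_cstar (L : ℕ) (hL9 : 9 ≤ L) (hL1 : 1 ≤ L) (β : ℝ) (len : Site 4 → ℝ) :
    ∃ i : ZdIdx 4 L, i.k = 2 ∧ IdxB8LawsB L i ∧ DomainSeq L i.Ω ∧ i.Ω 0 = Set.univ ∧ i.Ω = cubeFam true L 0 1 L 2 ∧
      ¬ B8SectGH.Prop7PrintedR (fun _ : Unit => zdGF3 𝔸 L β len i) (fun _ => toAxialTower 𝔸 L β len hL1 i) := by
  have hL2 : 2 ≤ L := by omega
  have hLr : (9 : ℝ) ≤ L := by exact_mod_cast hL9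
  have hLpos : (0 : ℝ) < L := by linarith
  have hL0 : (L : ℝ) ≠ 0 := hLpos.ne'
  -- the member: print's family `(T, □₁, □₂)` at `k = 2`, `η = L⁻²`
  have hη : (0 : ℝ) < ((L : ℝ) ^ 2)⁻¹ := by positivity
  have hscale : (L : ℝ) ^ 2 * ((L : ℝ) ^ 2)⁻¹ ≤ 1 := by rw [mul_inv_cancel₀ (pow_ne_zero 2 hL0)]
  obtain ⟨i, hik, hiη, hΩ, -, -, -, hlaws⟩ :=
    exists_topCube_member_lawsB (d := 4) hL1 (0 : Site 4) 1 (le_refl L) (k := 2) (by norm_num) hη hscale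
  have hds : DomainSeq L i.Ω := by rw [hΩ]; exact cubeFam_domainSeq true hL1 (0 : Site 4) 1 (le_refl L) 2
  have hΩ0 : i.Ω 0 = Set.univ := by rw [hΩ]; exact cubeFam_true_zero L 0 1 L 2
  have hΩ1 : i.Ω 1 = cube L (0 : Site 4) 1 L 2 1 := by rw [hΩ]; exact cubeFam_of_pos true L 0 1 L le_rfl one_le_two
  have hΩ2 : i.Ω 2 = cube L (0 : Site 4) 1 L 2 2 := by rw [hΩ]; exact cubeFam_of_pos true L 0 1 L one_le_two le_rfl
  refine ⟨i, hik, hlaws, hds, hΩ0, hΩ, ?_⟩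
  rintro ⟨c, hc, H⟩
  -- the smallness parameters
  set α₂ : ℝ := min c (min (1 / 32) (cst 4 L)) with hα₂
  have hcst : 0 < cst 4 L := cst_pos (by norm_num) L hL1
  have h0 : 0 < α₂ := lt_min hc (lt_min (by norm_num) hcst)
  have hc2 : α₂ ≤ c := min_le_left _ _
  have h32 : α₂ ≤ 1 / 32 := (min_le_right _ _).trans (min_le_left _ _)
  have hcs : α₂ ≤ cst 4 L := (min_le_right _ _).trans (min_le_right _ _)
  have h16 : 16 * α₂ ≤ 1 := by linarith
  set κ₀ : ℝ := 9999 / 10000 * α₂ / (L : ℝ) ^ 2 with hκ₀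
  have hκ₀pos : 0 < κ₀ := by positivity
  have hκ₀L2 : κ₀ * (L : ℝ) ^ 2 = 9999 / 10000 * α₂ := by rw [hκ₀]; field_simp
  have hκ₀L2lt : κ₀ * (L : ℝ) ^ 2 < α₂ := by rw [hκ₀L2]; linarith
  have hL1r : (1 : ℝ) ≤ L := by exact_mod_cast hL1
  have hκ₀L : κ₀ * L < α₂ := lt_of_le_of_lt (by nlinarith) hκ₀L2lt
  -- the corners of `□₂`, `□₁`
  have hsqHi2 : ∀ j : Fin 4, sqHi L (0 : Site 4) 1 L 2 2 j = (L : ℤ) := fun j => by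
    simp [sqHi, bHi, gs_zero]
  have hsqLo2 : ∀ j : Fin 4, sqLo L (0 : Site 4) L 2 2 j = -(L : ℤ) := fun j => by
    simp [sqLo, bLo, gs_zero]
  have hgs1 : gs L 1 = L + 1 := by rw [gs_succ, gs_zero, mul_one]
  have hsqHi1 : ∀ j : Fin 4, sqHi L (0 : Site 4) 1 L 2 1 j = (L : ℤ) - 1 + L * (L + 1) := fun j => by
    simp [sqHi, bHi, hgs1]
  have hsqLo1 : ∀ j : Fin 4, sqLo L (0 : Site 4) L 2 1 j = -((L : ℤ) * (L + 1)) := fun j => by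
    simp [sqLo, bLo, hgs1]
  have hmem2 : ∀ y : Site 4, y ∈ i.Ω 2 ↔ ∀ j, -((L : ℤ) ^ 2 * L) ≤ y j ∧ y j ≤ (L : ℤ) ^ 2 * (L + 1) - 1 := by
    intro y
    rw [hΩ2]
    show InBox _ _ y ↔ _
    simp only [InBox, tlo_apply, thi_apply, hsqLo2, hsqHi2, mul_neg]
  have hmem1 : ∀ y : Site 4, y ∈ i.Ω 1 ↔ ∀ j, (L : ℤ) * -((L : ℤ) * (L + 1)) ≤ y j ∧ y j ≤ (L : ℤ) * ((L : ℤ) - 1 + L * (L + 1) + 1) - 1 := by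
    intro y
    rw [hΩ1]
    show InBox _ _ y ↔ _
    simp only [InBox, tlo_apply, thi_apply, hsqLo1, hsqHi1, pow_one]
  -- the towers `T = B²(w)` and `T′ = B¹(z′)`, the bond `⟨x, x + e₀⟩`
  set w : Site 4 := fun _ => (L : ℤ) with hwdef
  set rt : Fin 4 → Fin L := fun _ => ⟨L - 1, by omega⟩ with hrtdef
  set zz : Site 4 := (L : ℤ) • w + boxVec L rt with hzzdef
  set x : Site 4 := (L : ℤ) • zz + boxVec L rt with hxdef
  set z' : Site 4 := zz + e 0 with hz'def
  set r' : Fin 4 → Fin L := fun j => if j = 0 then ⟨0, by omega⟩ else ⟨L - 1, by omega⟩ with hr'def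
  have hrt : ∀ j, boxVec L rt j = (L : ℤ) - 1 := fun j => by simp [boxVec, hrtdef, Nat.cast_sub hL1]
  have hw : ∀ j, w j = L := fun _ => rfl
  have hzz : ∀ j, zz j = L * L + (L - 1) := fun j => by
    rw [hzzdef, Pi.add_apply, Pi.smul_apply, smul_eq_mul, hrt]
  have hx : ∀ j, x j = L * (L * L + (L - 1)) + (L - 1) := fun j => by
    rw [hxdef, Pi.add_apply, Pi.smul_apply, smul_eq_mul, hrt, hzz]
  have hz'0 : z' 0 = L * L + L := by rw [hz'def, Pi.add_apply, hzz, e_apply, if_pos rfl]; ring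
  have hz'j : ∀ j, j ≠ 0 → z' j = L * L + (L - 1) := fun j hj => by rw [hz'def, Pi.add_apply, hzz, e_apply, if_neg hj, add_zero]
  have hx' : x + e 0 = (L : ℤ) • z' + boxVec L r' := by
    funext j
    by_cases hj : j = 0
    · subst hj
      rw [Pi.add_apply, hx, e_apply, if_pos rfl, Pi.add_apply, Pi.smul_apply, smul_eq_mul, hz'0]
      simp [boxVec, hr'def]; ring
    · rw [Pi.add_apply, hx, e_apply, if_neg hj, Pi.add_apply, Pi.smul_apply, smul_eq_mul, hz'j j hj]
      simp [boxVec, hr'def, hj, Nat.cast_sub hL1]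
  have hx'0 : (x + e 0 : Site 4) 0 = L * (L * L + (L - 1)) + (L - 1) + 1 := by rw [Pi.add_apply, hx, e_apply, if_pos rfl]
  have hflx : fl L x = zz := fl_block hL1 zz rt
  have hflzz : fl L zz = w := fl_block hL1 w rt
  have hflx' : fl L (x + e 0) = z' := by rw [hx']; exact fl_block hL1 z' r'
  have hUwx : Under L 2 w x := under_succ_of_under_block (under_one_block L w rt) (under_one_block L zz rt)
  have hUz'x' : Under L 1 z' (x + e 0) := by rw [hx']; exact under_one_block L z' r'
  -- `T ⊂ □₂`, `T′ ⊂ □₁`, `x + e₀ ∉ □₂`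
  have hTsub : ∀ y, InBox (tlo L w 2) (thi L w 2) y → y ∈ i.Ω 2 := by
    intro y hy
    rw [hmem2]
    intro j
    obtain ⟨h1, h2⟩ := hy j
    rw [tlo_apply] at h1
    rw [thi_apply] at h2
    change (L : ℤ) ^ 2 * (L : ℤ) ≤ y j at h1
    change y j ≤ (L : ℤ) ^ 2 * ((L : ℤ) + 1) - 1 at h2
    constructor <;> nlinarith
  have hT'sub : ∀ y, InBox (tlo L z' 1) (thi L z' 1) y → y ∈ i.Ω 1 := by
    intro y hy
    rw [hmem1]
    intro j
    obtain ⟨h1, h2⟩ := hy j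
    rw [tlo_apply, pow_one] at h1
    rw [thi_apply, pow_one] at h2
    have hzb : L * L + (L - 1) ≤ z' j ∧ z' j ≤ L * L + L := by
      by_cases hj : j = 0
      · subst hj; rw [hz'0]; constructor <;> linarith
      · rw [hz'j j hj]; constructor <;> linarith
    constructor <;> nlinarith [hzb.1, hzb.2]
  have hx'not2 : x + e 0 ∉ i.Ω 2 := by
    rw [hmem2]
    intro h
    have := (h 0).2
    rw [hx'0] at this
    nlinarith
  -- tower memberships through the cover law №11
  have hwtop : w ∈ i.Λs i.k i.k := by
    obtain ⟨j, hj1, hj2, y, hy, hU⟩ := hlaws.toIdxB8Laws.cover i.k le_rfl w (by rw [hik]; exact hTsub)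
    have hjk : j = i.k := le_antisymm hj2 hj1
    subst hjk
    rw [Nat.sub_self, under_zero_iff] at hU
    rw [hU]; exact hy
  have hz'top : z' ∈ i.Λs i.k 1 := by
    obtain ⟨j, hj1, hj2, y, hy, hU⟩ := hlaws.toIdxB8Laws.cover 1 (by rw [hik]; norm_num) z' hT'sub
    rw [hik] at hj2
    rcases eq_or_lt_of_le hj1 with hj | hj
    · subst hj
      rw [Nat.sub_self, under_zero_iff] at hU
      rw [hU]; exact hy
    · exfalso
      have hj2' : j = 2 := by omega
      subst hj2'
      -- `z′` would lie one level under a top of `□₂^{(2)}`, so `x + e₀ ∈ □₂`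
      have hU2 : Under L 2 y (x + e 0) := under_succ_of_under_block hU hUz'x'
      have hIB : InBox (tlo L y 2) (thi L y 2) (x + e 0) := fun i' =>
        ⟨((under_iff_tower L 2 y (x + e 0)).1 hU2).1 i', ((under_iff_tower L 2 y (x + e 0)).1 hU2).2 i'⟩
      exact hx'not2 (i.htower 2 (by rw [hik]) y hy (x + e 0) hIB)
  have hx'max : ∀ J, 1 < J → J ≤ i.k → ¬ InTower L (i.Λs i.k) J (x + e 0) := by
    intro J hJ1 hJ2 ⟨y, hy, hU⟩
    rw [hik] at hJ2
    have hJ : J = 2 := by omega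
    subst hJ
    have hIB : InBox (tlo L y 2) (thi L y 2) (x + e 0) := fun i' =>
      ⟨((under_iff_tower L 2 y (x + e 0)).1 hU).1 i', ((under_iff_tower L 2 y (x + e 0)).1 hU).2 i'⟩
    exact hx'not2 (i.htower 2 (by rw [hik]) y hy (x + e 0) hIB)
  -- the witness potential `ψ = κ₀(Σ_i y_i + q(y₀ − N))`
  set N : ℤ := (x + e 0 : Site 4) 0 with hNdef
  have hN : N = L * (L * L + (L - 1)) + (L - 1) + 1 := hx'0
  set q : ℤ → ℝ := fun t => (if t ≤ 1 then (0 : ℝ) else if t ≤ (L : ℤ) then ((t : ℤ) : ℝ) * (((t : ℤ) : ℝ) - 1) / 2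
        else (L : ℝ) * ((L : ℝ) - 1) / 2 + ((L : ℝ) - 1) * (((t : ℤ) : ℝ) - L)) with hqdef
  set ψ : Site 4 → ℝ := fun y => κ₀ * ((∑ j, ((y j : ℤ) : ℝ)) + q (y 0 - N)) with hψdef
  obtain ⟨hΔbd, hΔin, hΔΔbd, hΔΔin⟩ := potential_bounds L hL2 N hκ₀pos q (fun _ => rfl) ψ (fun _ => rfl)
  -- where `□₂`-touching bonds sit: left of `N`
  have htouch2 : ∀ (y : Site 4) (τ : Fin 4), SideTouches (i.Ω 2) y τ → y 0 - N ≤ -1 ∨ τ ≠ 0 := by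
    intro y τ hst
    by_cases hτ : τ = 0
    · subst hτ
      left
      have hS : ∀ c ∈ i.Ω 2, c 0 ≤ (L : ℤ) ^ 2 * (L + 1) - 1 := fun c hc => ((hmem2 c).1 hc 0).2
      have := sideTouches_coord_le hS hst
      rw [hN]; nlinarith
    · exact Or.inr hτ
  have h1 : ∀ j, j ≤ i.k → ∀ (y : Site 4) (τ : Fin 4), SideTouches (i.Ω j) y τ → (L : ℝ) ^ j * |ψ (y + e τ) - ψ y| < α₂ := by
    intro j hj y τ hst
    rw [hik] at hj
    interval_cases j
    · rw [pow_zero, one_mul]; exact (hΔbd y τ).trans_lt hκ₀L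
    · rw [pow_one]
      calc (L : ℝ) * |ψ (y + e τ) - ψ y| ≤ L * (κ₀ * L) := mul_le_mul_of_nonneg_left (hΔbd y τ) hLpos.le
        _ = κ₀ * (L : ℝ) ^ 2 := by ring
        _ < α₂ := hκ₀L2lt
    · rw [hΔin y τ (htouch2 y τ hst), abs_of_pos hκ₀pos, mul_comm]; exact hκ₀L2lt
  have h2 : ∀ j, j ≤ i.k → ∀ (y : Site 4) (τ κ : Fin 4), SideTouches (i.Ω j) y τ →
      ((L : ℝ) ^ j) ^ 2 * |(ψ (y + e κ + e τ) - ψ (y + e κ)) - (ψ (y + e τ) - ψ y)| < α₂ := by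
    intro j hj y τ κ hst
    rw [hik] at hj
    have hj2 : ((L : ℝ) ^ j) ^ 2 * |(ψ (y + e κ + e τ) - ψ (y + e κ)) - (ψ (y + e τ) - ψ y)| ≤ ((L : ℝ) ^ j) ^ 2 * κ₀ :=
      mul_le_mul_of_nonneg_left (hΔΔbd y τ κ) (by positivity)
    interval_cases j
    · refine hj2.trans_lt ?_
      rw [pow_zero, one_pow, one_mul]
      exact lt_of_le_of_lt (le_mul_of_one_le_right hκ₀pos.le hL1r) hκ₀L
    · refine hj2.trans_lt ?_
      rw [pow_one, mul_comm]; exact hκ₀L2lt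
    · rw [hΔΔin y τ κ (htouch2 y τ hst), abs_zero, mul_zero]; exact h0
  -- (1.139), (1.140) for the pure gauge `U₁ = e^{iηA}`, `A = −dψ∕η`, at `U₀ = 1`
  have hall : ∀ (y : Site 4) (τ : Fin 4), SideTouches (i.Ω 0) y τ := fun y τ => by
    rw [hΩ0]
    by_cases hτ : τ = 0
    · subst hτ
      exact B8Eq140Level.sideTouches_of_bondTouches (κ := 1) (by decide) (Or.inl (Set.mem_univ _))
    · exact B8Eq140Level.sideTouches_of_bondTouches (κ := 0) (fun h => hτ h.symm) (Or.inl (Set.mem_univ _))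
  set A : Site 4 → Fin 4 → 𝔸 := fun z τ => algebraMap ℂ 𝔸 ((((ψ z - ψ (z + e τ)) / i.η : ℝ)) : ℂ) with hAdef
  have hAh : ∀ (y : Site 4) (κ : Fin 4), IsSelfAdjoint (A y κ) := fun _ _ => IsSelfAdjoint.algebraMap 𝔸 (Complex.conj_ofReal _)
  have hAeq : cfgExp i.η A = gaugeAct (fun y => expUnit (algebraMap ℂ 𝔸 (I * ((ψ y : ℝ) : ℂ)))) 1 := cfgExp_potential_eq_gaugeAct_cu i.hη.ne' ψ
  let U₀ : (zdGF3 𝔸 L β len i).Cfg := ⟨1, fun _ _ => (unitaryUnits 𝔸).one_mem⟩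
  let U₁ : {U : Site 4 → Fin 4 → 𝔸ˣ // ∀ y κ, U y κ ∈ unitaryUnits 𝔸} := ⟨cfgExp i.η A, fun y κ => cfgExp_mem_unitaryUnits i.η hAh y κ⟩
  let P : (zdGF3 𝔸 L β len i).Pert := (U₀, U₁)
  have hInA : (zdGF3 𝔸 L β len i).InA α₂ U₀ := by
    show InAk L i.k i.η α₂ i.Ω (1 : Site 4 → Fin 4 → 𝔸ˣ)
    exact B8Prop6OfThm4.one_inAk hL1 i.k i.hη h0 i.Ω
  have h140 : (zdGF3 𝔸 L β len i).C140 α₂ U₀ P := c140_zdGF3_potential (𝔸 := 𝔸) hL1 β len i hall ψ h0 h16 h1 h2 U₀ rfl P rfl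
  -- print's map in its unitary regime
  have hunit := fun y => (uTower_facts (𝔸 := 𝔸) (β := β) (len := len) (by norm_num : 2 ≤ 4) hL2 i hΩ0 h0 hcs h0 hcs
    U₀ P hInA h140 y).1
  have hTA := toAxialTower_of_unitary (𝔸 := 𝔸) (β := β) (len := len) hL1 i U₀ P hunit
  -- the box-form (1.145) at level `0` on the bond `⟨x, x + e₀⟩` (box trivially in `Ω₀ = ℤ⁴`)
  obtain ⟨-, havg⟩ := H () α₂ α₂ h0 hc2 h0 hc2 U₀ P hInA h140
  have hle := havg 0 (Nat.zero_le _) x 0 (fun y _ => by rw [hΩ0]; exact Set.mem_univ y)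
  dsimp only at hle
  rw [hTA] at hle
  change ‖(((mulCfg (mgauge (1 : Site 4 → Fin 4 → 𝔸ˣ) (uTower L hL1 i.k (i.Λs i.k) (1 : Site 4 → Fin 4 → 𝔸ˣ) (cfgExp i.η A))
      (cfgExp i.η A)) (1 : Site 4 → Fin 4 → 𝔸ˣ)) x 0 : 𝔸ˣ) : 𝔸) - (((1 : Site 4 → Fin 4 → 𝔸ˣ) x 0 : 𝔸ˣ) : 𝔸)‖ ≤ 2 * α₂ at hle
  rw [mulCfg_eq_mul, hAeq] at hle
  -- `uTower` is the depth-2 fixing on `T` and the depth-1 fixing on `T′`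
  have hux : uTower L hL1 i.k (i.Λs i.k) (1 : Site 4 → Fin 4 → 𝔸ˣ) (gaugeAct (fun y => expUnit (algebraMap ℂ 𝔸 (I * ((ψ y : ℝ) : ℂ)))) 1) x
      = glev L hL1 (1 : Site 4 → Fin 4 → 𝔸ˣ) (gaugeAct (fun y => expUnit (algebraMap ℂ 𝔸 (I * ((ψ y : ℝ) : ℂ)))) 1) 2 0 x := by
    rw [uTower_of_maximal (hL := hL1) (U₀ := (1 : Site 4 → Fin 4 → 𝔸ˣ)) (U₁ := gaugeAct (fun y => expUnit (algebraMap ℂ 𝔸 (I * ((ψ y : ℝ) : ℂ)))) 1) le_rfl hwtop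
      (by rw [hik]; exact hUwx) (fun J hJ hJk _ => absurd (lt_of_lt_of_le hJ hJk) (lt_irrefl _)), hik]
  have huxe : uTower L hL1 i.k (i.Λs i.k) (1 : Site 4 → Fin 4 → 𝔸ˣ) (gaugeAct (fun y => expUnit (algebraMap ℂ 𝔸 (I * ((ψ y : ℝ) : ℂ)))) 1) (x + e 0)
      = glev L hL1 (1 : Site 4 → Fin 4 → 𝔸ˣ) (gaugeAct (fun y => expUnit (algebraMap ℂ 𝔸 (I * ((ψ y : ℝ) : ℂ)))) 1) 1 0 (x + e 0) :=
    uTower_of_maximal (hL := hL1) (U₀ := (1 : Site 4 → Fin 4 → 𝔸ˣ)) (U₁ := gaugeAct (fun y => expUnit (algebraMap ℂ 𝔸 (I * ((ψ y : ℝ) : ℂ)))) 1)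
      (by rw [hik]; norm_num) hz'top hUz'x' hx'max
  -- the block means of the potential, their values at `w` and `z′`, and the series-logarithm smallness
  set M₁ : Site 4 → ℝ := fun z => ∑ r : Fin 4 → Fin L, ((L : ℝ) ^ 4)⁻¹ * ψ ((L : ℤ) • z + boxVec L r) with hM₁def
  set M₂ : Site 4 → ℝ := fun v => ∑ s : Fin 4 → Fin L, ((L : ℝ) ^ 4)⁻¹ * M₁ ((L : ℤ) • v + boxVec L s) with hM₂def
  obtain ⟨-, hM₁N, hM₂T⟩ := block_means L hL1 N κ₀ q (fun _ => rfl) ψ (fun _ => rfl) M₁ (fun _ => rfl) M₂ (fun _ => rfl)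
  have hz'N : (L : ℤ) * z' 0 - N = 0 := by rw [hz'0, hN]; ring
  obtain ⟨hψ2, hM2, hψ1⟩ := smallness L hL9 N hκ₀pos h32 hκ₀L2 q (fun _ => rfl) ψ (fun _ => rfl) M₁ (fun _ => rfl) w hw hN z' hz'N
  have hblk : ∀ (s : Fin 4 → Fin L) (t : Fin L), (L : ℤ) * (((L : ℤ) • w + boxVec L s) 0) + ((t : ℕ) : ℤ) - N ≤ 1 := by
    intro s t
    have hs : ((s 0 : ℕ) : ℤ) ≤ (L : ℤ) - 1 := by have := (s 0).isLt; omega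
    have ht : ((t : ℕ) : ℤ) ≤ (L : ℤ) - 1 := by have := t.isLt; omega
    simp only [Pi.add_apply, Pi.smul_apply, smul_eq_mul, boxVec, hw]
    rw [hN]; nlinarith
  have hSw : (∑ j, ((w j : ℤ) : ℝ)) = 4 * L := by
    rw [Fin.sum_univ_four]
    change (((L : ℤ) : ℝ)) + ((L : ℤ) : ℝ) + ((L : ℤ) : ℝ) + ((L : ℤ) : ℝ) = 4 * (L : ℝ)
    push_cast; ring
  have hSz' : (∑ j, ((z' j : ℤ) : ℝ)) = 4 * (L : ℝ) ^ 2 + 4 * L - 3 := by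
    rw [Fin.sum_univ_four, hz'0, hz'j 1 (by decide), hz'j 2 (by decide), hz'j 3 (by decide)]
    push_cast; ring
  have hM₂w := hM₂T w hblk
  have hM₁z' := hM₁N z' (by linarith [hz'N])
  rw [hSw] at hM₂w
  rw [hSz'] at hM₁z'
  -- the left member of (1.145) on the bond, in closed form, and the arithmetic
  rw [norm_mgauge_interTower_sub_one_cu L hL1 ψ M₁ M₂ (fun _ => rfl) (fun _ => rfl) _ x 0 hux huxe
    (fun s r => by rw [hflx, hflzz]; exact hψ2 s r) (fun s => by rw [hflx, hflzz]; exact hM2 s)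
    (fun r => by rw [hflx']; exact hψ1 r), hflx, hflzz, hflx', hM₂w, hM₁z'] at hle
  exact final_arith hLr h0 h32 hκ₀pos hκ₀L2 hle

/-- **The `d`-keyed form** (lattice dimension `d` GIVEN AS A LETTER with `d = 4` — the shape a record reads at `d := θ.D`). [cite: Balaban1985RegularSpaces, Prop. 7 (1.143)–(1.145) p.100, (1.3)–(1.6) p.77] -/
theorem not_prop7PrintedR_zdGF3_toAxialTower_boxForm_cstar_dim {d : ℕ} (hd : d = 4) (L : ℕ) (hL9 : 9 ≤ L) (hL1 : 1 ≤ L) (β : ℝ) (len : Site d → ℝ) :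
    ∃ i : ZdIdx d L, i.k = 2 ∧ IdxB8LawsB L i ∧ DomainSeq L i.Ω ∧ i.Ω 0 = Set.univ ∧
      ¬ B8SectGH.Prop7PrintedR (fun _ : Unit => zdGF3 𝔸 L β len i) (fun _ => toAxialTower 𝔸 L β len hL1 i) := by
  subst hd
  obtain ⟨i, hik, hlaws, hadm, hΩ0, -, hnot⟩ := not_prop7PrintedR_zdGF3_toAxialTower_boxForm_cstar 𝔸 L hL9 hL1 β len
  exact ⟨i, hik, hlaws, hadm, hΩ0, hnot⟩

end Certificate

/-! ## §4 The record faces at EVERY `θ : Node00.Stage3Params` with `θ.D = 4`, `θ.L ≥ 9` (any coefficient algebra `θ.𝔸`) -/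

section Record

open Node00 (Stage3Params IdxB8 famB8OfRecord famB8OfRecordSubBH)
open B8Prop7TowerAxialRecord (toAxialTowerResid)
open B8LeafKnit (prop7PrintedR_precomp)

variable (θ : Stage3Params) (hD : θ.D = 4) (hL9 : 9 ≤ θ.L) (β : ℝ) (len : Site θ.D → ℝ)

include hD hL9 in
/-- ★ **A LAWFUL `k = 2` MEMBER OF THE SUB-INDEX AT WHICH THE BOX-FORM TYPED-PRINTED PROPOSITION 7 ALREADY FAILS, AT EVERY RECORD `θ` WITH `θ.D = 4`, `θ.L ≥ 9`**
(any `θ.𝔸`, `β`, `len`). [cite: Balaban1985RegularSpaces, Prop. 7 (1.143)–(1.145) p.100, (1.66) p.88, (1.131) p.99] -/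
theorem exists_idxB8SubB_not_prop7PrintedR_boxForm :
    ∃ j : IdxB8SubB θ, j.1.1.k = 2 ∧ DomainSeq θ.L j.1.1.Ω ∧
      ¬ B8SectGH.Prop7PrintedR (fun _ : Unit => famB8OfRecordSubB θ β len j) (fun _ => toAxialTowerResid θ β len j.1) := by
  have hL1 : 1 ≤ θ.L := by omega
  obtain ⟨i, hik, hlaws, hadm, hΩ0, hnot⟩ := not_prop7PrintedR_zdGF3_toAxialTower_boxForm_cstar_dim θ.𝔸 hD θ.L hL9 hL1 β len
  exact ⟨⟨⟨i, hΩ0⟩, hlaws⟩, hik, hadm, hnot⟩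

include hD hL9 in
/-- ★★ **THE BOX-FORM `p7` BINDER OF THE SubB KNITS WITH THE AXIAL MAP PINNED IS FALSE AT EVERY RECORD `θ` WITH `θ.D = 4`, `θ.L ≥ 9`** (any `θ.𝔸`).
[cite: Balaban1985RegularSpaces, Prop. 7 (1.143)–(1.145) p.100, (1.35) p.82, (1.66) p.88] -/
theorem not_prop7PrintedR_famB8OfRecordSubB_toAxialTowerResid :
    ¬ B8SectGH.Prop7PrintedR (fun j : IdxB8SubB θ => famB8OfRecordSubB θ β len j) (fun j => toAxialTowerResid θ β len j.1) := by
  obtain ⟨j, -, -, hnot⟩ := exists_idxB8SubB_not_prop7PrintedR_boxForm θ hD hL9 β len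
  exact fun h => hnot (prop7PrintedR_precomp (fun _ : Unit => j) _ _ h)

include hD hL9 in
/-- ★★ **… OVER THE WHOLE FAMILY OF RECORD** `famB8OfRecord θ β len` with the candidate pin `toAxialTowerResid θ β len` of `ResidB8.toAxial`, at every record `θ`
with `θ.D = 4`, `θ.L ≥ 9`. [cite: Balaban1985RegularSpaces, Prop. 7 (1.143)–(1.145) p.100, (1.66) p.88] -/
theorem not_prop7PrintedR_famB8OfRecord_toAxialTowerResid :
    ¬ B8SectGH.Prop7PrintedR (famB8OfRecord θ β len) (toAxialTowerResid θ β len) := by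
  obtain ⟨j, -, -, hnot⟩ := exists_idxB8SubB_not_prop7PrintedR_boxForm θ hD hL9 β len
  exact fun h => hnot (prop7PrintedR_precomp (fun _ : Unit => j.1) _ _ h)

include hD hL9 in
/-- ★★ **… AND AT THE REPAIRED-CARRIER TWIN `famB8OfRecordSubBH`** (`rfl` fields), every record `θ` with `θ.D = 4`, `θ.L ≥ 9`.
[cite: Balaban1985RegularSpaces, Prop. 7 (1.143)–(1.145) p.100, (1.66) p.88] -/
theorem not_prop7PrintedR_famB8OfRecordSubBH_toAxialTowerResid :
    ¬ B8SectGH.Prop7PrintedR (fun j : IdxB8SubB θ => famB8OfRecordSubBH θ β len j) (fun j => toAxialTowerResid θ β len j.1) := by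
  obtain ⟨j, -, -, hnot⟩ := exists_idxB8SubB_not_prop7PrintedR_boxForm θ hD hL9 β len
  exact fun h => hnot (prop7PrintedR_precomp (fun _ : Unit => j) _ _ h)

end Record

end Literature.MathematicalPhysics.QuantumFieldTheory.Balaban1983to89.B8Prop7PrintedRZdGF3BoxFormInterTowerCStar

end
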